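import Mathlib.Data.Real.Basic
import Mathlib.Order.Monotone.Basic
import Mathlib.Tactic

/-!
# Literature.Probability.FitznerVanDerHofstad2017.F3Bounds — the `f₃` improvement bounds of the NoBLE analysis, typed

A fact-free, numeral-free REPRODUCTION of the Mathematica functions of `General.nb` In[2]–In[3] (the published
supplementary notebook of Fitzner–van der Hofstad, EJP 22 (2017) no. 43, implementing §3.3.5 of the NoBLE paper
PTRF 169 (2017)): the five summands `BoundH[1..5,…]` of the final bound (3.87) on the bootstrap function `f₃`
(= the right sides of (3.71), (3.74), (3.77), (3.78), (3.86), pp. 1074–1079), their sum `BoundH`, the cell maximum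
`BoundFThree` and the initial-point bound `BoundFThreeInital` ((3.30)–(3.31), p. 1070), as real-valued functions of

* an SRW integral table `τ : Tables ν` (`IM = J_{n,l}`, `T = T_{n,l}`, `U = U_{n,l}`, `K = K_{n,l}` of §3.3.4 / §5.2,
  indexed by `n`, `l` and a node `v : ν`; `IM` is indexed by `n : ℤ` because (3.71) at `n = 0` uses `J_{−1,l}`), and
* the ten `β`-arguments `a : Args` (`Γ₂′ = ((2d−2)/(2d−1))Γ₂`, `c̄_Φ`, `α̲_F`, `ᾱ_F`, `β_{α,Φ}`, `β_{R,F}`, `β_{R,Φ}`,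
  `β_{|ΔR,F|}`, `β_{ΔR,Φ}`, `K̲ = 1/(α̲_F − β_{ΔR,F})`), in the notebook's argument order.

WHY THIS FILE EXISTS (build `lace`, node N28 / REFEREE R6).  The d = 10 "no-go by monotone escape" needs the bound
map to be ORDER-PRESERVING.  `BoundH[1,2,4,5]` are increasing in every upper-bound argument and decreasing in `α̲_F`
on the well-formed region (`Args.WF`: `α̲_F > 0`, the rest `≥ 0`; tables `≥ 0`), which is proved here
(`boundH1_mono`, …); `BoundH[3]` contains `Max[|α̲_F − 1|, |ᾱ_F − 1|]`, which is NOT monotone (MARGINS.md M3), and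
this file provides the monotone MINORANT `boundH3Mono` (that `Max` replaced by `max (ᾱ_F − 1) (1 − α̲_F) 0`, the
carver's `General.mono.py`) with `boundH3Mono_le_boundH3` and `boundH3Mono_mono`.  Nothing here is a cited fact:
every declaration is a definition transcribed from the notebook or a theorem proved from it.  For `n ≥ 3` the
notebook's `BoundH[1,…]` returns the sentinel `-1` ("not implemented"); we reproduce that literally (only `n ≤ 2`
is ever used: the index set 𝒮 of EJP (2.34) has `n ∈ {0,1}`).

[cite: FitznerVanDerHofstad2016NoBLE, §3.3.5 (3.71)–(3.87) pp. 1074–1079 and (3.30)–(3.31) p. 1070;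
 FitznerVanDerHofstad2017, supplementary notebook General.nb In[2]–In[3]]
-/

noncomputable section

namespace Literature.Probability.FitznerVanDerHofstad2017
namespace F3Bounds

/-- The SRW integral tables of [NoBLE16, §3.3.4/§5.2] entering the `f₃` bounds, indexed by `n`, `l` and a node
`v : ν` (the notebook's vectors `{0},{1},{2},{0,1},{3},{1,1},{0,0,1}` = `0, e₁, e₁+e₂, 2e₁, e₁+e₂+e₃, 2e₁+e₂, 3e₁`).
`IM n l v` = the bound on `J_{n,l}(v)` ((3.29)–(3.30); `SRW.nb` `IM[n,l,v]`, used for `n ≥ −1`), `T`, `U`, `K` =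
the bounds on `T_{n,l}(v)`, `U_{n,l}(v)`, `K_{n,l}(v)` ((3.35)–(3.38), §5.2).  [folklore] -/
structure Tables (ν : Type*) where
  /-- `IM[n,l,v]`, bound on `J_{n,l}(v)`; `n : ℤ` (the case `n = −1` occurs in (3.71) at `n = 0`) -/
  IM : ℤ → ℕ → ν → ℝ
  /-- `T[n,l,v]`, bound on `T_{n,l}(v)` -/
  T : ℕ → ℕ → ν → ℝ
  /-- `U[n,l,v]`, bound on `U_{n,l}(v)` -/
  U : ℕ → ℕ → ν → ℝ
  /-- `K[n,l,v]`, bound on `K_{n,l}(v)` -/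
  K : ℕ → ℕ → ν → ℝ

/-- All table entries are non-negative (they bound non-negative lattice sums). [folklore] -/
structure Tables.Nonneg {ν : Type*} (τ : Tables ν) : Prop where
  IM : ∀ n l v, 0 ≤ τ.IM n l v
  T : ∀ n l v, 0 ≤ τ.T n l v
  U : ∀ n l v, 0 ≤ τ.U n l v
  K : ∀ n l v, 0 ≤ τ.K n l v

/-- The ten `β`-arguments of `General.nb` `BoundH[i, d, n, l, v, Gamma2dash, cp, afmin, afmax, ap, bRf, bRp,
bRfDelta, bRpDelta, Kunderline]`, in the notebook's order and with its names. [folklore] -/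
structure Args where
  /-- `Γ₂′ = ((2d−2)/(2d−1))·Γ₂` (the assumed bound on `(2d−2)/(2d−1)·sup[1−D̂]Ĝ`) -/
  Gamma2dash : ℝ
  /-- `c̄_Φ` (D.2, upper) -/
  cp : ℝ
  /-- `α̲_F` (D.3, lower) — the only LOWER-bound argument -/
  afmin : ℝ
  /-- `ᾱ_F` (D.3, upper) -/
  afmax : ℝ
  /-- `β_{α,Φ}` (D.4) -/
  ap : ℝ
  /-- `β_{R,F}` (D.13) (passed but unused by `BoundH`) -/
  bRf : ℝ
  /-- `β_{R,Φ}` (D.14) -/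
  bRp : ℝ
  /-- `β_{|ΔR,F|}` (D.29) -/
  bRfDelta : ℝ
  /-- `β_{ΔR,Φ}` (D.21) -/
  bRpDelta : ℝ
  /-- `K̲ := 1/(α̲_F − β_{ΔR,F})` (Percolation.nb: `1/(beta[af,Lower,s] + beta[Rf,Lower,Delta,s])`) -/
  Kunderline : ℝ

/-- The information order on `Args`: `a ≼ b` ("`b` dominates `a`") iff every upper-bound argument of `a` is `≤`
that of `b` and the lower-bound argument `α̲_F` is `≥`.  This is the order in which the bound map must be
preserved (MARGINS.md §5 M3). [folklore] -/
structure Args.Dom (a b : Args) : Prop where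
  Gamma2dash : a.Gamma2dash ≤ b.Gamma2dash
  cp : a.cp ≤ b.cp
  afmin : b.afmin ≤ a.afmin
  afmax : a.afmax ≤ b.afmax
  ap : a.ap ≤ b.ap
  bRf : a.bRf ≤ b.bRf
  bRp : a.bRp ≤ b.bRp
  bRfDelta : a.bRfDelta ≤ b.bRfDelta
  bRpDelta : a.bRpDelta ≤ b.bRpDelta
  Kunderline : a.Kunderline ≤ b.Kunderline

/-- Well-formed arguments: `α̲_F > 0` and all other arguments `≥ 0` (the region in which (3.71)–(3.86) are bounds
at all; on the admissible region of the bootstrap `α̲_F > β_{ΔR,F} ≥ 0`). [folklore] -/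
structure Args.WF (a : Args) : Prop where
  Gamma2dash : 0 ≤ a.Gamma2dash
  cp : 0 ≤ a.cp
  afmin : 0 < a.afmin
  afmax : 0 ≤ a.afmax
  ap : 0 ≤ a.ap
  bRp : 0 ≤ a.bRp
  bRfDelta : 0 ≤ a.bRfDelta
  bRpDelta : 0 ≤ a.bRpDelta
  Kunderline : 0 ≤ a.Kunderline

/-- The information order is reflexive. [folklore] -/
theorem Args.Dom.refl (a : Args) : Args.Dom a a :=
  ⟨le_rfl, le_rfl, le_rfl, le_rfl, le_rfl, le_rfl, le_rfl, le_rfl, le_rfl, le_rfl⟩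

/-- The information order is transitive. [folklore] -/
theorem Args.Dom.trans {a b c : Args} (h₁ : Args.Dom a b) (h₂ : Args.Dom b c) : Args.Dom a c :=
  ⟨h₁.1.trans h₂.1, h₁.2.trans h₂.2, h₂.3.trans h₁.3, h₁.4.trans h₂.4, h₁.5.trans h₂.5, h₁.6.trans h₂.6,
    h₁.7.trans h₂.7, h₁.8.trans h₂.8, h₁.9.trans h₂.9, h₁.10.trans h₂.10⟩

variable {ν : Type*}

/-- `General.nb` `BoundH[1, d, n, l, v, …]` = the right side of [NoBLE16, (3.71)] (cases `n = 0, 1, 2`: (3.61),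
(3.64), (3.68)+(3.70)); for `n ≥ 3` the notebook returns the sentinel `-1` (reproduced).
[cite: FitznerVanDerHofstad2016NoBLE, §3.3.5 (3.61)–(3.71) pp. 1074–1077; FitznerVanDerHofstad2017, notebook General.nb In[2]] -/
def boundH1 (τ : Tables ν) (n l : ℕ) (v : ν) (a : Args) : ℝ :=
  match n with
  | 0 => a.cp * τ.IM 0 l v + a.ap * τ.IM 0 (l+1) v + a.ap / a.afmin * τ.IM (-1) l v
  | 1 => a.cp ^ 2 / a.afmin * τ.IM 1 l v + a.cp * a.ap / a.afmin * τ.IM 0 l v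
        + 2 * (a.ap * a.cp / a.afmin) * τ.IM 1 (l+1) v + a.ap ^ 2 / a.afmin * τ.IM 0 (l+1) v
        + a.ap ^ 2 / a.afmin * τ.IM 1 (l+2) v
        + (a.bRp + a.bRfDelta * a.Gamma2dash) / a.afmin ^ 2
            * (a.cp * τ.T 3 l v + a.ap * τ.T 3 (l+1) v + a.ap * τ.T 2 l v)
  | 2 => a.cp ^ 3 / a.afmin ^ 2 * τ.IM 2 l v + a.cp ^ 2 * a.ap / a.afmin ^ 2 * τ.IM 1 l v
        + 3 * (a.ap * a.cp ^ 2 / a.afmin ^ 2) * τ.IM 2 (l+1) v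
        + 2 * a.cp ^ 2 * a.ap / a.afmin ^ 2 * τ.IM 1 (l+1) v
        + 3 * (a.ap ^ 2 * a.cp / a.afmin ^ 2) * τ.IM 2 (l+2) v
        + a.ap ^ 3 / a.afmin ^ 2 * τ.IM 1 (l+2) v + a.ap ^ 3 / a.afmin ^ 2 * τ.IM 2 (l+3) v
        + (a.bRp + a.bRfDelta * a.Gamma2dash) / a.afmin ^ 2 * (a.cp / a.afmin + a.Gamma2dash)
            * (a.cp * τ.T 4 l v + a.ap * τ.T 4 (l+1) v + a.ap * τ.T 3 l v)
        + a.ap * ((a.bRp + a.bRfDelta * a.Gamma2dash) / a.afmin ^ 3)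
            * (a.cp * τ.T 4 (l+1) v + a.ap * τ.T 4 (l+2) v + a.ap * τ.T 3 (l+1) v)
  | _ + 3 => -1

/-- `General.nb` `BoundH[2, …]` = the right side of [NoBLE16, (3.74)].
[cite: FitznerVanDerHofstad2016NoBLE, §3.3.5 (3.74) p. 1077; FitznerVanDerHofstad2017, notebook General.nb In[2]] -/
def boundH2 (τ : Tables ν) (n l : ℕ) (v : ν) (a : Args) : ℝ :=
  a.bRfDelta * a.Gamma2dash ^ n * a.Kunderline
      * ((a.cp * τ.T (n+2) l v + a.ap * τ.T (n+2) (l+1) v) * (1 / a.afmin + a.Kunderline)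
          + a.ap / a.afmin * τ.T (n+1) l v)
    + a.afmax * a.bRpDelta * a.Kunderline ^ 2 * τ.T (n+2) l v

/-- The non-monotone factor of `BoundH[3,…]`: `Max[Abs[afmin − 1], Abs[afmax − 1]]`. [folklore] -/
def m3 (a : Args) : ℝ := max |a.afmin - 1| |a.afmax - 1|

/-- Its monotone minorant (carver, `General.mono.py`): `max (ᾱ_F − 1) (1 − α̲_F) 0` — increasing in `ᾱ_F`,
decreasing in `α̲_F`, and `≤ m3`. [folklore] -/
def m3Mono (a : Args) : ℝ := max (max (a.afmax - 1) (1 - a.afmin)) 0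

/-- `General.nb` `BoundH[3, …]` = the right side of [NoBLE16, (3.77)] (contains `Max[|α̲_F − 1|, |ᾱ_F − 1|]`).
[cite: FitznerVanDerHofstad2016NoBLE, §3.3.5 (3.77) p. 1077; FitznerVanDerHofstad2017, notebook General.nb In[2]] -/
def boundH3 (τ : Tables ν) (n l : ℕ) (v : ν) (a : Args) : ℝ :=
  2 * a.Kunderline ^ 2 * a.Gamma2dash ^ n * a.ap * (a.bRfDelta / a.afmin + m3 a) * τ.U (n+2) l v
    + 2 * a.Kunderline ^ 2 * a.Gamma2dash ^ (n+1) * (a.afmax * m3 a + a.bRfDelta) * τ.U (n+3) l v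

/-- The monotone minorant of `BoundH[3,…]`: `m3` replaced by `m3Mono` (MARGINS.md §5, M3 patch). [folklore] -/
def boundH3Mono (τ : Tables ν) (n l : ℕ) (v : ν) (a : Args) : ℝ :=
  2 * a.Kunderline ^ 2 * a.Gamma2dash ^ n * a.ap * (a.bRfDelta / a.afmin + m3Mono a) * τ.U (n+2) l v
    + 2 * a.Kunderline ^ 2 * a.Gamma2dash ^ (n+1) * (a.afmax * m3Mono a + a.bRfDelta) * τ.U (n+3) l v

/-- `General.nb` `BoundH[4, …]` = the right side of [NoBLE16, (3.78)].
[cite: FitznerVanDerHofstad2016NoBLE, §3.3.5 (3.78) p. 1077; FitznerVanDerHofstad2017, notebook General.nb In[2]] -/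
def boundH4 (τ : Tables ν) (n l : ℕ) (v : ν) (a : Args) : ℝ :=
  a.Kunderline * (a.bRpDelta * τ.K n l v + a.bRfDelta * a.Gamma2dash * τ.K (n+1) l v)

/-- `General.nb` `BoundH[5, …]` = the right side of [NoBLE16, (3.86)] (`af` = `ᾱ_F`).
[cite: FitznerVanDerHofstad2016NoBLE, §3.3.5 (3.86) p. 1079; FitznerVanDerHofstad2017, notebook General.nb In[2]] -/
def boundH5 (τ : Tables ν) (n l : ℕ) (v : ν) (a : Args) : ℝ :=
  2 * a.Kunderline ^ 2 * a.Gamma2dash ^ (n+1) * (2 * a.afmax * a.bRfDelta + a.bRfDelta ^ 2) * τ.U (n+3) l v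
    + 2 * a.Kunderline ^ 2 * a.Gamma2dash ^ n
        * (a.afmax * a.bRpDelta + (a.ap + a.bRpDelta) * a.bRfDelta) * τ.U (n+2) l v

/-- `General.nb` `BoundH[d, n, l, v, …] := Sum[BoundH[i, …], {i, 1, 5}]` = the numerator of [NoBLE16, (3.87)].
[cite: FitznerVanDerHofstad2016NoBLE, §3.3.5 (3.87) p. 1079; FitznerVanDerHofstad2017, notebook General.nb In[2]] -/
def boundH (τ : Tables ν) (n l : ℕ) (v : ν) (a : Args) : ℝ :=
  boundH1 τ n l v a + boundH2 τ n l v a + boundH3 τ n l v a + boundH4 τ n l v a + boundH5 τ n l v a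

/-- The monotone minorant of `BoundH` (only the third summand changes). [folklore] -/
def boundHMono (τ : Tables ν) (n l : ℕ) (v : ν) (a : Args) : ℝ :=
  boundH1 τ n l v a + boundH2 τ n l v a + boundH3Mono τ n l v a + boundH4 τ n l v a + boundH5 τ n l v a

/-- `General.nb` In[3] `BoundFThree[d, n, l, vecs, …] := Max over the nodes v ∈ vecs of BoundH[d,n,l,v,…]` — the
`sup_{x ∈ S}` of (3.87) for one index `{n,l,S}`; `vecs` is a non-empty list, rendered as head + tail.
[cite: FitznerVanDerHofstad2016NoBLE, §3.3.5 (3.87) p. 1079; FitznerVanDerHofstad2017, notebook General.nb In[3]] -/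
def boundFThree (τ : Tables ν) (n l : ℕ) (v₀ : ν) (vs : List ν) (a : Args) : ℝ :=
  vs.foldr (fun v acc => max (boundH τ n l v a) acc) (boundH τ n l v₀ a)

/-- The monotone minorant of `BoundFThree` (cellwise `boundHMono`). [folklore] -/
def boundFThreeMono (τ : Tables ν) (n l : ℕ) (v₀ : ν) (vs : List ν) (a : Args) : ℝ :=
  vs.foldr (fun v acc => max (boundHMono τ n l v a) acc) (boundHMono τ n l v₀ a)

/-- `General.nb` In[3] `BoundFThreeInital[d, n, l, rho, vecs] := Max over v ∈ vecs of
rho·((2d−2)/(2d−1))^(n+1)·IM[n,l,v]` (the power applies to the fraction ONLY; `rho` is a separate factor and every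
call of `Percolation.nb` passes `rho = 1` — raw `General.nb` l.1681–1690, HOME/DIVERGENCE.md D36(a), REFEREE R33) —
the initial-point bound [NoBLE16, (3.30)–(3.31)] on `f₃(z_I)` for one index; (3.31) as PRINTED has the exponent `1`,
the notebook's `n+1` is D36(b).
[cite: FitznerVanDerHofstad2016NoBLE, §3.3.3 (3.30)–(3.31) p. 1070; FitznerVanDerHofstad2017, notebook General.nb In[3]] -/
def boundFThreeInitial (τ : Tables ν) (d : ℝ) (n l : ℕ) (rho : ℝ) (v₀ : ν) (vs : List ν) : ℝ :=
  vs.foldr (fun v acc => max (rho * ((2*d-2)/(2*d-1)) ^ (n+1) * τ.IM n l v) acc)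
    (rho * ((2*d-2)/(2*d-1)) ^ (n+1) * τ.IM n l v₀)

/-- The same bound with the exponent of [NoBLE16] (3.31) AS PRINTED: `rho·((2d−2)/(2d−1))·IM[n,l,v]` (exponent `1`
instead of the notebook's `n+1`; HOME/DIVERGENCE.md D36(b), REFEREE R33 — the "print-only" variant of the initial-point
cells).  For `n ≥ 0`, `rho ≥ 0` and tables `≥ 0` it dominates `boundFThreeInitial` (`boundFThreeInitial_le_printed`).
[cite: FitznerVanDerHofstad2016NoBLE, §3.3.3 (3.31) p. 1070] -/
def boundFThreeInitialPrinted (τ : Tables ν) (d : ℝ) (n l : ℕ) (rho : ℝ) (v₀ : ν) (vs : List ν) : ℝ :=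
  vs.foldr (fun v acc => max (rho * ((2*d-2)/(2*d-1)) * τ.IM n l v) acc)
    (rho * ((2*d-2)/(2*d-1)) * τ.IM n l v₀)

/-! ## Order properties -/

section Mono

variable {τ : Tables ν} (hτ : τ.Nonneg) {a b : Args}

/-- `m3Mono ≥ 0`. [folklore] -/
theorem m3Mono_nonneg (a : Args) : 0 ≤ m3Mono a := le_max_right _ _

/-- The minorant is one: `m3Mono ≤ m3`. [folklore] -/
theorem m3Mono_le_m3 (a : Args) : m3Mono a ≤ m3 a := by
  unfold m3Mono m3
  refine max_le (max_le ?_ ?_) ?_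
  · exact (le_abs_self _).trans (le_max_right _ _)
  · have : 1 - a.afmin ≤ |a.afmin - 1| := by
      rw [abs_sub_comm]; exact le_abs_self _
    exact this.trans (le_max_left _ _)
  · exact (abs_nonneg _).trans (le_max_left _ _)

/-- `m3Mono` is monotone in the information order. [folklore] -/
theorem m3Mono_mono (h : Args.Dom a b) : m3Mono a ≤ m3Mono b := by
  unfold m3Mono
  have h3 := h.afmin; have h4 := h.afmax
  refine max_le_max (max_le_max ?_ ?_) le_rfl <;> linarith

include hτ

/-- `boundH3Mono ≤ boundH3` on well-formed arguments (the M3 patch is a minorant). [folklore] -/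
theorem boundH3Mono_le_boundH3 (ha : a.WF) (n l : ℕ) (v : ν) :
    boundH3Mono τ n l v a ≤ boundH3 τ n l v a := by
  unfold boundH3Mono boundH3
  have := m3Mono_le_m3 a
  have hK := ha.Kunderline; have hG := ha.Gamma2dash; have hap := ha.ap; have haf := ha.afmax
  have hU2 := hτ.U (n+2) l v; have hU3 := hτ.U (n+3) l v
  gcongr

/-- (3.71) is monotone in the information order on well-formed arguments. [folklore] -/
theorem boundH1_mono (ha : a.WF) (hb : b.WF) (h : Args.Dom a b) (n l : ℕ) (v : ν) :
    boundH1 τ n l v a ≤ boundH1 τ n l v b := by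
  obtain ⟨hG, hcp, haf, hafx, hap, hRp, hRfD, hRpD, hK⟩ := ha
  obtain ⟨hG', hcp', haf', hafx', hap', hRp', hRfD', hRpD', hK'⟩ := hb
  obtain ⟨dG, dcp, daf, dafx, dap, dRf, dRp, dRfD, dRpD, dK⟩ := h
  have hIM := hτ.IM; have hT := hτ.T
  match n with
  | 0 =>
    have := hIM 0 l v; have := hIM 0 (l+1) v; have := hIM (-1) l v
    simp only [boundH1]; gcongr
  | 1 =>
    have := hIM 1 l v; have := hIM 0 l v; have := hIM 1 (l+1) v; have := hIM 0 (l+1) v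
    have := hIM 1 (l+2) v; have := hT 3 l v; have := hT 3 (l+1) v; have := hT 2 l v
    simp only [boundH1]; gcongr
  | 2 =>
    have := hIM 2 l v; have := hIM 1 l v; have := hIM 2 (l+1) v; have := hIM 1 (l+1) v
    have := hIM 2 (l+2) v; have := hIM 1 (l+2) v; have := hIM 2 (l+3) v
    have := hT 4 l v; have := hT 4 (l+1) v; have := hT 3 l v; have := hT 4 (l+2) v; have := hT 3 (l+1) v
    simp only [boundH1]; gcongr
  | _ + 3 => simp only [boundH1]; exact le_rfl

/-- (3.74) is monotone in the information order on well-formed arguments. [folklore] -/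
theorem boundH2_mono (ha : a.WF) (hb : b.WF) (h : Args.Dom a b) (n l : ℕ) (v : ν) :
    boundH2 τ n l v a ≤ boundH2 τ n l v b := by
  obtain ⟨hG, hcp, haf, hafx, hap, hRp, hRfD, hRpD, hK⟩ := ha
  obtain ⟨hG', hcp', haf', hafx', hap', hRp', hRfD', hRpD', hK'⟩ := hb
  obtain ⟨dG, dcp, daf, dafx, dap, dRf, dRp, dRfD, dRpD, dK⟩ := h
  have := hτ.T (n+2) l v; have := hτ.T (n+2) (l+1) v; have := hτ.T (n+1) l v
  simp only [boundH2]
  gcongr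

/-- The M3-patched (3.77) is monotone in the information order on well-formed arguments. [folklore] -/
theorem boundH3Mono_mono (ha : a.WF) (hb : b.WF) (h : Args.Dom a b) (n l : ℕ) (v : ν) :
    boundH3Mono τ n l v a ≤ boundH3Mono τ n l v b := by
  have hm := m3Mono_mono h
  have hm0 := m3Mono_nonneg a
  obtain ⟨hG, hcp, haf, hafx, hap, hRp, hRfD, hRpD, hK⟩ := ha
  obtain ⟨hG', hcp', haf', hafx', hap', hRp', hRfD', hRpD', hK'⟩ := hb
  obtain ⟨dG, dcp, daf, dafx, dap, dRf, dRp, dRfD, dRpD, dK⟩ := h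
  have := hτ.U (n+2) l v; have := hτ.U (n+3) l v
  simp only [boundH3Mono]
  gcongr

/-- (3.78) is monotone in the information order on well-formed arguments. [folklore] -/
theorem boundH4_mono (ha : a.WF) (hb : b.WF) (h : Args.Dom a b) (n l : ℕ) (v : ν) :
    boundH4 τ n l v a ≤ boundH4 τ n l v b := by
  obtain ⟨hG, hcp, haf, hafx, hap, hRp, hRfD, hRpD, hK⟩ := ha
  obtain ⟨hG', hcp', haf', hafx', hap', hRp', hRfD', hRpD', hK'⟩ := hb
  obtain ⟨dG, dcp, daf, dafx, dap, dRf, dRp, dRfD, dRpD, dK⟩ := h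
  have := hτ.K n l v; have := hτ.K (n+1) l v
  simp only [boundH4]
  gcongr

/-- (3.86) is monotone in the information order on well-formed arguments. [folklore] -/
theorem boundH5_mono (ha : a.WF) (hb : b.WF) (h : Args.Dom a b) (n l : ℕ) (v : ν) :
    boundH5 τ n l v a ≤ boundH5 τ n l v b := by
  obtain ⟨hG, hcp, haf, hafx, hap, hRp, hRfD, hRpD, hK⟩ := ha
  obtain ⟨hG', hcp', haf', hafx', hap', hRp', hRfD', hRpD', hK'⟩ := hb
  obtain ⟨dG, dcp, daf, dafx, dap, dRf, dRp, dRfD, dRpD, dK⟩ := h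
  have := hτ.U (n+3) l v; have := hτ.U (n+2) l v
  simp only [boundH5]
  gcongr

/-- The M3-patched numerator of (3.87) is monotone in the information order on well-formed arguments. [folklore] -/
theorem boundHMono_mono (ha : a.WF) (hb : b.WF) (h : Args.Dom a b) (n l : ℕ) (v : ν) :
    boundHMono τ n l v a ≤ boundHMono τ n l v b := by
  unfold boundHMono
  gcongr
  · exact boundH1_mono hτ ha hb h n l v
  · exact boundH2_mono hτ ha hb h n l v
  · exact boundH3Mono_mono hτ ha hb h n l v
  · exact boundH4_mono hτ ha hb h n l v
  · exact boundH5_mono hτ ha hb h n l v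

/-- The M3 patch is a minorant of the numerator of (3.87). [folklore] -/
theorem boundHMono_le_boundH (ha : a.WF) (n l : ℕ) (v : ν) :
    boundHMono τ n l v a ≤ boundH τ n l v a := by
  unfold boundHMono boundH
  have := boundH3Mono_le_boundH3 hτ ha n l v
  linarith

/-- `boundFThreeMono` is monotone in the information order on well-formed arguments. [folklore] -/
theorem boundFThreeMono_mono (ha : a.WF) (hb : b.WF) (h : Args.Dom a b) (n l : ℕ) (v₀ : ν) (vs : List ν) :
    boundFThreeMono τ n l v₀ vs a ≤ boundFThreeMono τ n l v₀ vs b := by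
  unfold boundFThreeMono
  induction vs with
  | nil => simpa using boundHMono_mono hτ ha hb h n l v₀
  | cons v vs ih =>
    simp only [List.foldr_cons]
    exact max_le_max (boundHMono_mono hτ ha hb h n l v) ih

/-- `boundFThreeMono ≤ boundFThree` on well-formed arguments. [folklore] -/
theorem boundFThreeMono_le (ha : a.WF) (n l : ℕ) (v₀ : ν) (vs : List ν) :
    boundFThreeMono τ n l v₀ vs a ≤ boundFThree τ n l v₀ vs a := by
  unfold boundFThreeMono boundFThree
  induction vs with
  | nil => simpa using boundHMono_le_boundH hτ ha n l v₀
  | cons v vs ih =>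
    simp only [List.foldr_cons]
    exact max_le_max (boundHMono_le_boundH hτ ha n l v) ih

omit hτ in
/-- `boundFThreeInitial` is monotone in `rho` (for `d ≥ 1`, tables `≥ 0`; it is linear in `rho`). [folklore] -/
theorem boundFThreeInitial_mono (hτ : τ.Nonneg) {d : ℝ} (hd : 1 ≤ d) (n l : ℕ) {rho rho' : ℝ}
    (h : rho ≤ rho') (v₀ : ν) (vs : List ν) :
    boundFThreeInitial τ d n l rho v₀ vs ≤ boundFThreeInitial τ d n l rho' v₀ vs := by
  unfold boundFThreeInitial
  have hq : 0 ≤ ((2*d-2)/(2*d-1)) ^ (n+1) := pow_nonneg (div_nonneg (by linarith) (by linarith)) _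
  have hIM := hτ.IM
  have step : ∀ v, rho * ((2*d-2)/(2*d-1)) ^ (n+1) * τ.IM n l v
      ≤ rho' * ((2*d-2)/(2*d-1)) ^ (n+1) * τ.IM n l v := by
    intro v
    have := hIM n l v
    gcongr
  induction vs with
  | nil => simpa using step v₀
  | cons v vs ih =>
    simp only [List.foldr_cons]
    exact max_le_max (step v) ih

omit hτ in
/-- The notebook's initial-point bound (exponent `n+1`) is at most the printed one (exponent `1`): `q^(n+1) ≤ q` for
`q = (2d−2)/(2d−1) ∈ [0,1]`. [folklore] -/
theorem boundFThreeInitial_le_printed (hτ : τ.Nonneg) {d : ℝ} (hd : 1 ≤ d) (n l : ℕ) {rho : ℝ} (h0 : 0 ≤ rho)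
    (v₀ : ν) (vs : List ν) :
    boundFThreeInitial τ d n l rho v₀ vs ≤ boundFThreeInitialPrinted τ d n l rho v₀ vs := by
  unfold boundFThreeInitial boundFThreeInitialPrinted
  have hq0 : 0 ≤ (2*d-2)/(2*d-1) := div_nonneg (by linarith) (by linarith)
  have hq1 : (2*d-2)/(2*d-1) ≤ 1 := (div_le_one (by linarith)).2 (by linarith)
  have hpow : ((2*d-2)/(2*d-1)) ^ (n+1) ≤ (2*d-2)/(2*d-1) := by
    calc ((2*d-2)/(2*d-1)) ^ (n+1) ≤ ((2*d-2)/(2*d-1)) ^ 1 := pow_le_pow_of_le_one hq0 hq1 (by omega)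
      _ = (2*d-2)/(2*d-1) := pow_one _
  have hIM := hτ.IM
  have step : ∀ v, rho * ((2*d-2)/(2*d-1)) ^ (n+1) * τ.IM n l v ≤ rho * ((2*d-2)/(2*d-1)) * τ.IM n l v := by
    intro v
    have := hIM n l v
    gcongr
  induction vs with
  | nil => simpa using step v₀
  | cons v vs ih =>
    simp only [List.foldr_cons]
    exact max_le_max (step v) ih

end Mono

end F3Bounds
end Literature.Probability.FitznerVanDerHofstad2017

end
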